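import Literature.AlgebraicGeometry.Frobenioids.ArchimedeanProp35iArithmeticBases
import Literature.AlgebraicGeometry.Frobenioids.ArchimedeanProp35iSchemaClosure
import Literature.AlgebraicGeometry.Frobenioids.Thm36SubInstancesA
import Literature.AlgebraicGeometry.Frobenioids.Thm36SubInstancesB
import Literature.AlgebraicGeometry.Frobenioids.ArchimedeanFrobenioidRelative
import HarnessLib

/-!
# Frobenioids II, Prop. 3.5 (i) and Thm. 3.6 (vi) at `C`, `A`, `N`: HEAD-EXACT closers of the typed instance
# statements at the bases that occur (D-0079 L-F [FrdI/II], pack A, trunk `ArchimedeanTheoremsInstances.lean`)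

Mochizuki, *The geometry of Frobenioids II: poly-Frobenioids*, Kyushu J. Math. **62** (2008) 401–460, §3,
Proposition 3.5 (i), author's kurims text p. 34 [cite: MochizukiFrdII2008, Prop 3.5 (i) p.34]; Theorem 3.6
(vi), p. 37 [cite: MochizukiFrdII2008, Thm 3.6 (vi) p.37]; Example 3.3 (ii), p. 28.

PROOF-ONLY companion (abc-iut cell, seat abc-iut-f-015 gen 6; FACT-LIST rows F-0858 `Prop35i_C`, F-0857
`Prop35i_A`, F-0859 `Prop35i_N`, F-0882 `Thm36vi_CA` of abc-iut-L1-t9's statement file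
`ArchimedeanTheoremsInstances.lean`, never edited here).  The universal closures of these instance
statements are REFUTED in the tree (`ArchFrd.not_forall_prop35i_A`, `…_N`, `P35iToy.not_prop35i_C`,
`ArchFrd.not_forall_thm36vi_CA`); what the printed items assert is their truth over the bases and completion
data that actually occur.  The tree proves exactly that, but for `Prop35i_C` only as a CONJUNCT
(`ArchFrd.prop35i_all_ptBase.1`, `prop35i_all_of_faithful`, `prop35i_all_of_forall_isComplex`, abc-iut-w4-d100)
and for `Thm36vi_CA` modulo the derived hypothesis "`C` is a Frobenioid" (`ArchFrd.Thm36Sub.thm36vi_CA_holds`,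
abc-iut-L1-t9).  This file states the HEAD-EXACT forms the L-F ledger folds by name — one-line re-headings, no
new mathematics, no definition:

* `ArchFrd.prop35i_C_ptBase` / `prop35i_C_of_faithful` / `prop35i_C_of_forall_isComplex` (F-0858), and the
  faithful-base heads `prop35i_A_of_faithful` (F-0857), `prop35i_N_of_faithful` (F-0859);
* `ArchFrd.thm36vi_CA_of_isTotallyEpimorphic` (F-0882): Thm. 3.6 (vi) for `C^Λ` and `A` at THE perfection /
  realification data over EVERY base satisfying print's standing hypotheses of §3 ("`D` connected, totally
  epimorphic" — then `C` is a Frobenioid by Ex. 3.3 (ii), `ArchFrd.Ex33ii_isFrobenioid_holds`, abc-iut-L1-t6).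

Honest framing: typed ≠ proved elsewhere; these are OUR kernel checks of OUR typed instance forms of a refereed
paper; nothing here bears on [IUTchIII] Cor. 3.12 and no side is taken.
-/

namespace Literature.AlgebraicGeometry.Frobenioids

open CategoryTheory

noncomputable section

namespace ArchFrd

universe v u

variable {D : Type u} [Category.{v} D] (π : D ⥤ D0)

/-! ### Prop. 3.5 (i) for `H = C`, `A`, `N` — head-exact forms -/

/-- **[FrdII] Prop. 3.5 (i) for `H = C`, AS TYPED, at THE base of [IUTchI] Ex. 3.4 (i)** — the one-morphism
category at `Spec ℂ` (`ArchFrd.ptBase`): holds with no hypothesis (first conjunct of abc-iut-w4-d100's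
`prop35i_all_ptBase`). FACT-LIST F-0858, genuine instance. [cite: MochizukiFrdII2008, Prop 3.5 (i) p.34] -/
theorem prop35i_C_ptBase : Literature.AlgebraicGeometry.Frobenioids.ArchFrd.Prop35i_C ptBase :=
  prop35i_all_ptBase.1

/-- **[FrdII] Prop. 3.5 (i) for `H = C`, AS TYPED, over every FAITHFUL base functor `π : D → D₀`.**
FACT-LIST F-0858, print-generality form. [cite: MochizukiFrdII2008, Prop 3.5 (i) p.34] -/
theorem prop35i_C_of_faithful [π.Faithful] : Literature.AlgebraicGeometry.Frobenioids.ArchFrd.Prop35i_C π :=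
  (prop35i_all_of_faithful π).1

/-- **[FrdII] Prop. 3.5 (i) for `H = C`, AS TYPED, over every base all of whose objects are complex.**
FACT-LIST F-0858. [cite: MochizukiFrdII2008, Prop 3.5 (i) p.34] -/
theorem prop35i_C_of_forall_isComplex (hc : ∀ d : D, (π.obj d).IsComplex) :
    Literature.AlgebraicGeometry.Frobenioids.ArchFrd.Prop35i_C π :=
  (prop35i_all_of_forall_isComplex π hc).1

/-- **[FrdII] Prop. 3.5 (i) for `H = A`, AS TYPED, over every FAITHFUL base functor** (the `ptBase` and
complex-image heads are abc-iut-f-013's `prop35i_A_ptBase` / `prop35i_A_of_forall_isComplex`).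
FACT-LIST F-0857. [cite: MochizukiFrdII2008, Prop 3.5 (i) p.34] -/
theorem prop35i_A_of_faithful [π.Faithful] : Literature.AlgebraicGeometry.Frobenioids.ArchFrd.Prop35i_A π :=
  (prop35i_all_of_faithful π).2.1

/-- **[FrdII] Prop. 3.5 (i) for `H = N`, AS TYPED, over every FAITHFUL base functor** (the `ptBase` and
complex-image heads are abc-iut-f-013's `prop35i_N_ptBase` / `prop35i_N_of_forall_isComplex`).
FACT-LIST F-0859. [cite: MochizukiFrdII2008, Prop 3.5 (i) p.34] -/
theorem prop35i_N_of_faithful [π.Faithful] : Literature.AlgebraicGeometry.Frobenioids.ArchFrd.Prop35i_N π :=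
  (prop35i_all_of_faithful π).2.2.1

/-! ### Thm. 3.6 (vi) for `C^Λ` and `A` — the print-generality head -/

/-- **[FrdII] Thm. 3.6 (vi) for `C^Λ` (all `Λ`) and `A`, AS TYPED at THE perfection / realification data,
over every base satisfying print's standing hypotheses of §3** ("`D` a connected, totally epimorphic
category", p. 26): then `C = C₀ ×_{D₀} D` is a Frobenioid (Ex. 3.3 (ii), `ArchFrd.Ex33ii_isFrobenioid_holds`) and
abc-iut-L1-t9's `Thm36Sub.thm36vi_CA_holds` applies.  FACT-LIST F-0882, print-generality form (genuine
instance: `Thm36Sub.cpt_thm36vi`; the closure over ARBITRARY completion data is refuted by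
`ArchFrd.not_forall_thm36vi_CA`). [cite: MochizukiFrdII2008, Thm 3.6 (vi) p.37] -/
theorem thm36vi_CA_of_isTotallyEpimorphic (hD : IsGraphConnected D) (hTE : IsTotallyEpimorphic D) :
    Literature.AlgebraicGeometry.Frobenioids.ArchFrd.Thm36vi_CA π
      (Thm36Sub.pfCompletion π (Ex33ii_isFrobenioid_holds π hD hTE)) (Thm36Sub.rlfCompletion π) :=
  Thm36Sub.thm36vi_CA_holds π (Ex33ii_isFrobenioid_holds π hD hTE)

end ArchFrd

end

end Literature.AlgebraicGeometry.Frobenioids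

/-! ## v2 (append-only; abc-iut-f-015 gen 6, same session): Thm. 3.6 (i), (iv), (v), (ix) for `C^Λ` / `A` — the
print-generality heads under print's OWN standing hypotheses of [FrdII] §3 ("`D` connected, totally epimorphic",
p. 26), for the remaining instance rows of `ArchimedeanTheoremsInstances.lean` (FACT-LIST F-0868 `Thm36i_ampleTypes_C`,
F-0870 `Thm36i_istrTypes_C`, F-0871 `Thm36i_istr_all_C`, F-0877 `Thm36iv_C`, F-0878 `Thm36iv_readings_CA`,
F-0881 `Thm36v_C`, F-0879 `Thm36ix_CA`; F-0886 `Thm36x_CA` needs no hypothesis at all: `Thm36Sub.thm36x_CA_holds`).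
Each is abc-iut-L1-t9's / the Thm36Sub lineages' `…_holds (hF : IsFrobenioid (C.toElem π))` at THE perfection /
realification data, with `hF` DISCHARGED by Ex. 3.3 (ii) (`ArchFrd.Ex33ii_isFrobenioid_holds`); the genuine-instance
closers at the one-morphism base are the `Thm36Sub.cpt_…` theorems (abc-iut-w4-d074 lineage).  One line each, no new
mathematics; the ∀-closures over ARBITRARY completion data stay refuted by the `ArchimedeanTheoremsInstancesSchemaNegative*`
records. -/

namespace Literature.AlgebraicGeometry.Frobenioids

open CategoryTheory

noncomputable section

namespace ArchFrd

universe v' u'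

variable {D : Type u'} [Category.{v'} D] (π : D ⥤ D0)

/-- **[FrdII] Thm. 3.6 (i), the ampleness / metric-triviality / non-group-like clauses for `C^Λ` (all `Λ`), AS
TYPED at THE completion data, over every connected totally epimorphic base.** FACT-LIST F-0868.
[cite: MochizukiFrdII2008, Thm 3.6 (i) p.36] -/
theorem thm36i_ampleTypes_C_of_isTotallyEpimorphic (hD : IsGraphConnected D) (hTE : IsTotallyEpimorphic D) :
    Literature.AlgebraicGeometry.Frobenioids.ArchFrd.Thm36i_ampleTypes_C π
      (Thm36Sub.pfCompletion π (Ex33ii_isFrobenioid_holds π hD hTE)) (Thm36Sub.rlfCompletion π) :=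
  Thm36Sub.thm36i_ampleTypes_C_holds π (Ex33ii_isFrobenioid_holds π hD hTE)

/-- **[FrdII] Thm. 3.6 (i), "`(C^Λ)^istr` is of isotropic, base-trivial type" (all `Λ`), AS TYPED at THE completion
data, over every connected totally epimorphic base.** FACT-LIST F-0870. [cite: MochizukiFrdII2008, Thm 3.6 (i) p.36] -/
theorem thm36i_istrTypes_C_of_isTotallyEpimorphic (hD : IsGraphConnected D) (hTE : IsTotallyEpimorphic D) :
    Literature.AlgebraicGeometry.Frobenioids.ArchFrd.Thm36i_istrTypes_C π
      (Thm36Sub.pfCompletion π (Ex33ii_isFrobenioid_holds π hD hTE)) (Thm36Sub.rlfCompletion π) :=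
  Thm36Sub.thm36i_istrTypes_C_holds π (Ex33ii_isFrobenioid_holds π hD hTE)

/-- **[FrdII] Thm. 3.6 (i), "if `Λ ≥ ℚ` then `(C^Λ)^istr = C^Λ`", AS TYPED at THE completion data, over every
connected totally epimorphic base.** FACT-LIST F-0871. [cite: MochizukiFrdII2008, Thm 3.6 (i) p.36] -/
theorem thm36i_istr_all_C_of_isTotallyEpimorphic (hD : IsGraphConnected D) (hTE : IsTotallyEpimorphic D) :
    Literature.AlgebraicGeometry.Frobenioids.ArchFrd.Thm36i_istr_all_C π
      (Thm36Sub.pfCompletion π (Ex33ii_isFrobenioid_holds π hD hTE)) (Thm36Sub.rlfCompletion π) :=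
  Thm36Sub.thm36i_istr_all_C_holds π (Ex33ii_isFrobenioid_holds π hD hTE)

/-- **[FrdII] Thm. 3.6 (iv), first sentence, for `C^Λ` (all `Λ`), AS TYPED at THE completion data, over every
connected totally epimorphic base.** FACT-LIST F-0877. [cite: MochizukiFrdII2008, Thm 3.6 (iv) p.37] -/
theorem thm36iv_C_of_isTotallyEpimorphic (hD : IsGraphConnected D) (hTE : IsTotallyEpimorphic D) :
    Literature.AlgebraicGeometry.Frobenioids.ArchFrd.Thm36iv_C π
      (Thm36Sub.pfCompletion π (Ex33ii_isFrobenioid_holds π hD hTE)) (Thm36Sub.rlfCompletion π) :=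
  Thm36Sub.thm36iv_C_holds π (Ex33ii_isFrobenioid_holds π hD hTE)

/-- **[FrdII] Thm. 3.6 (iv), second sentence in its two repaired readings, for `C^Λ` and `A`, AS TYPED at THE
completion data, over every connected totally epimorphic base.** FACT-LIST F-0878.
[cite: MochizukiFrdII2008, Thm 3.6 (iv) p.37] -/
theorem thm36iv_readings_CA_of_isTotallyEpimorphic (hD : IsGraphConnected D) (hTE : IsTotallyEpimorphic D) :
    Literature.AlgebraicGeometry.Frobenioids.ArchFrd.Thm36iv_readings_CA π
      (Thm36Sub.pfCompletion π (Ex33ii_isFrobenioid_holds π hD hTE)) (Thm36Sub.rlfCompletion π) :=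
  Thm36Sub.thm36iv_readings_CA_holds π (Ex33ii_isFrobenioid_holds π hD hTE)

/-- **[FrdII] Thm. 3.6 (v) (the groups `O^×(A)`, all clauses) for `C^Λ` (all `Λ`), AS TYPED at THE completion
data, over every connected totally epimorphic base.** FACT-LIST F-0881. [cite: MochizukiFrdII2008, Thm 3.6 (v) p.37] -/
theorem thm36v_C_of_isTotallyEpimorphic (hD : IsGraphConnected D) (hTE : IsTotallyEpimorphic D) :
    Literature.AlgebraicGeometry.Frobenioids.ArchFrd.Thm36v_C π
      (Thm36Sub.pfCompletion π (Ex33ii_isFrobenioid_holds π hD hTE)) (Thm36Sub.rlfCompletion π) :=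
  Thm36Sub.thm36v_C_holds π (Ex33ii_isFrobenioid_holds π hD hTE)

/-- **[FrdII] Thm. 3.6 (ix) (strong indissectibility of `F^istr`) for `C^Λ` and `A`, AS TYPED at THE completion
data, over every connected totally epimorphic base** (the typed statement carries print's own hypotheses on `D` —
strongly indissectible, complexifiable or `Λ ≠ ℤ` — internally). FACT-LIST F-0879.
[cite: MochizukiFrdII2008, Thm 3.6 (ix) p.38] -/
theorem thm36ix_CA_of_isTotallyEpimorphic (hD : IsGraphConnected D) (hTE : IsTotallyEpimorphic D) :
    Literature.AlgebraicGeometry.Frobenioids.ArchFrd.Thm36ix_CA π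
      (Thm36Sub.pfCompletion π (Ex33ii_isFrobenioid_holds π hD hTE)) (Thm36Sub.rlfCompletion π) :=
  Thm36Sub.thm36ix_CA_holds π (Ex33ii_isFrobenioid_holds π hD hTE)

end ArchFrd

end

end Literature.AlgebraicGeometry.Frobenioids
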